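import Literature.AlgebraicGeometry.Resolution.HenselizationDirectedUnion
import Literature.AlgebraicGeometry.Resolution.ValuedFunctionFieldsLemmas
import HarnessLib

/-!
# The valuative datum of Thm. 3.3.1 at a finite level (descent of Thms. 3.2.3/3.2.6 to finite constants)

Topic: `Literature/AlgebraicGeometry/Resolution` (valued function fields). Groundwork for the
assembly of M. Temkin, *Inseparable local uniformization*, J. Algebra 373 (2013) 65–119 =
arXiv:0804.1554v3, Thm. 3.3.1 (tree: `Temkin2013RelativeCurveSmoothFibre`). Its valuative
input (Thm. 3.2.3 with Thm. 3.2.6) is naturally proved over an INFINITE field of constants: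
with `P` the perfect closure of the ground field `k` inside the ambient `(Ω, V)` (Thm. 3.2.6,
Step 2: "`k″ := \overline{k_p}` is the completed perfection of `k`") and `C ⊇ P` the relative
algebraic closure of `P` in the henselization of the function field `K₁P` (Thm. 3.2.3, Step 2:
"`L ⊂ K` is the completion of the field `K ∩ k^a` (which can be infinite over `k`)"), henselian
rationality reads `K₁ ≤ C(t)^h` for some `t ∈ K₁C`. The fact, and the chart datum of its
algebraic proof, want FINITELY MANY constants: a finite set `S ⊆ P` of purely inseparable ones
(the printed `k′/k`) and a finite set `Y ⊆ C` of constants separable over `k(S)` (the printed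
`lᵢ/k′`), with `t ∈ K₁·k(S, Y)`, `Y ⊆ (K₁·k(S))^h` and `K₁ ≤ k(S, Y)(t)^h` (Thm. 3.2.3, Step 2:
"`K` coincides with `\overline{l(T)}` already for a `k`-finite subfield `l ↪ L`"; Thm. 3.2.6,
Step 2: "then `T ∈ 𝒜 ⊗_k k′` already for a `k`-finite subfield `k′ ⊂ k_p`"). This file PROVES
that descent, by the directed-union principle of `HenselizationDirectedUnion.lean`
(the henselization of a directed union is the union of the henselizations):

* `isSeparable_of_forall_coeff_mem` — an element separable over `P` whose minimal
  polynomial has coefficients in a subfield `E ≤ P` is separable over `E` — PROVED;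
* `exists_finite_level_valuative_datum` — **the finite-level valuative datum** — PROVED.

All statements are [folklore] valuation/field theory; no definitions, no named facts.

## Sources

* M. Temkin, arXiv:0804.1554v3, proofs of Thm. 3.2.3 (Step 2) and Thm. 3.2.6 (Step 2),
  pp. 24–26 of the held arXiv text. [Temkin2013]
-/

noncomputable section

open Polynomial

namespace Literature.AlgebraicGeometry.Resolution

universe u

variable {Ω : Type u} [Field Ω] (V : ValuationSubring Ω)

omit V in
/-- **Separability descends with the coefficients of the minimal polynomial**: if `y` is
separable over a subfield `P` and the minimal polynomial of `y` over `P` has all its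
coefficients in a subfield `E ≤ P`, then `y` is separable over `E`. [folklore] -/
theorem isSeparable_of_forall_coeff_mem {E P : Subfield Ω} (hEP : E ≤ P) {y : Ω}
    (hy : IsSeparable P y) (hcoef : ∀ i, ((minpoly P y).coeff i : Ω) ∈ E) : IsSeparable E y := by
  classical
  let f : E →+* P := Subfield.inclusion hEP
  have hlifts : minpoly P y ∈ Polynomial.lifts f := by
    rw [Polynomial.lifts_iff_coeff_lifts]
    intro n
    exact ⟨⟨(minpoly P y).coeff n, hcoef n⟩, Subtype.ext rfl⟩
  obtain ⟨q, hq⟩ := (Polynomial.mem_lifts _).mp hlifts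
  have hqsep : q.Separable := by
    rw [← Polynomial.separable_map f, hq]
    exact hy
  have hqy : aeval y q = 0 := by
    have h1 : aeval y (q.map f) = 0 := by rw [hq]; exact minpoly.aeval P y
    have hcomp : (algebraMap P Ω).comp f = algebraMap E Ω := RingHom.ext fun _ => rfl
    rw [Polynomial.aeval_def, Polynomial.eval₂_map, hcomp, ← Polynomial.aeval_def] at h1
    exact h1
  exact hqsep.of_dvd (minpoly.dvd E y hqy)

variable [IsAlgClosed Ω]

/-- **The finite-level valuative datum.** Let `k ≤ K₁` be subfields of `(Ω, V)` with `K₁|k`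
finitely generated, `k ≤ P ≤ C` subfields with `C ≤ (K₁ ⊔ P)^h` and every element of `C`
separable over `P` (e.g. `P` perfect and `C` algebraic over it), and suppose `K₁ ≤ C(t)^h` for
some `t ∈ K₁ ⊔ C` (henselian rationality over the big constant field `C`). Then there are
finite sets `S ⊆ P` and `Y ⊆ C` with: every `y ∈ Y` separable over `k(S)`,
`t ∈ K₁ ⊔ k(S, Y)`, `Y ⊆ (K₁ ⊔ k(S))^h`, and `K₁ ≤ k(S, Y)(t)^h`. [folklore]
[cite: Temkin2013, proof of Thm. 3.2.3 (Step 2) and of Thm. 3.2.6 (Step 2)] -/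
theorem exists_finite_level_valuative_datum {k K₁ P C : Subfield Ω} (hkP : k ≤ P) (hPC : P ≤ C)
    (hfg : FGOver k K₁) (hCsep : ∀ c ∈ C, IsSeparable P c)
    (hCh : C ≤ henselization V (K₁ ⊔ P)) {t : Ω} (ht : t ∈ K₁ ⊔ C)
    (hgen : K₁ ≤ henselization V (Subfield.closure ((C : Set Ω) ∪ {t}))) :
    ∃ (S Y : Finset Ω), (↑S : Set Ω) ⊆ P ∧ (↑Y : Set Ω) ⊆ C ∧
      (∀ y ∈ Y, IsSeparable (Subfield.closure ((k : Set Ω) ∪ ↑S)) y) ∧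
      t ∈ K₁ ⊔ Subfield.closure ((k : Set Ω) ∪ ↑S ∪ ↑Y) ∧
      (↑Y : Set Ω) ⊆ henselization V (K₁ ⊔ Subfield.closure ((k : Set Ω) ∪ ↑S)) ∧
      K₁ ≤ henselization V (Subfield.closure ((k : Set Ω) ∪ ↑S ∪ ↑Y ∪ {t})) := by
  classical
  have hH := Kuhlmann2010HenselizationIsHenselian_holds.{u}
  have hkC : k ≤ C := hkP.trans hPC
  obtain ⟨G, hG⟩ := hfg
  have hkK₁ : k ≤ K₁ := fun c hc => hG ▸ Subfield.subset_closure (Or.inl hc)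
  have hGK₁ : (↑G : Set Ω) ⊆ K₁ := fun g hg => hG ▸ Subfield.subset_closure (Or.inr hg)
  ------------------------------------------------------------------
  -- ### Step 1: finitely many separable constants `Y ⊆ C`
  ------------------------------------------------------------------
  -- (1a) `K₁ ≤ (P ∪ Y₁ ∪ {t})^h`
  obtain ⟨Y₁, hY₁C, hY₁⟩ := exists_finset_closure_le_henselization_closure_levels V hPC {t}
    (B := (k : Set Ω)) (fun c hc => Subfield.subset_closure (Or.inl (hkP hc))) G
    (fun g hg => hgen (hGK₁ hg))
  rw [hG] at hY₁
  -- (1b) `t ∈ closure (P ∪ Y₂ ∪ K₁)`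
  have ht' : t ∈ Subfield.closure ((C : Set Ω) ∪ (K₁ : Set Ω)) := by
    have : K₁ ⊔ C ≤ Subfield.closure ((C : Set Ω) ∪ (K₁ : Set Ω)) :=
      sup_le (fun x hx => Subfield.subset_closure (Or.inr hx))
        (fun x hx => Subfield.subset_closure (Or.inl hx))
    exact this ht
  obtain ⟨Y₂, hY₂C, hY₂⟩ := exists_finset_forall_mem_closure_levels hPC (K₁ : Set Ω) {t}
    (fun z hz => by rw [Finset.mem_singleton.mp hz]; exact ht')
  have htY₂ : t ∈ Subfield.closure ((P : Set Ω) ∪ ↑Y₂ ∪ (K₁ : Set Ω)) :=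
    hY₂ t (Finset.mem_singleton_self t)
  set Y : Finset Ω := Y₁ ∪ Y₂ with hYdef
  have hYC : (↑Y : Set Ω) ⊆ C := by
    rw [hYdef, Finset.coe_union]; exact Set.union_subset hY₁C hY₂C
  have hK₁Y : K₁ ≤ henselization V (Subfield.closure ((P : Set Ω) ∪ ↑Y ∪ {t})) := by
    refine hY₁.trans (henselization_mono V hH (Subfield.closure_mono ?_))
    rw [hYdef, Finset.coe_union]
    exact Set.union_subset_union_left _ (Set.union_subset_union_right _ Set.subset_union_left)
  have htY : t ∈ Subfield.closure ((P : Set Ω) ∪ ↑Y ∪ (K₁ : Set Ω)) := by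
    refine Subfield.closure_mono ?_ htY₂
    rw [hYdef, Finset.coe_union]
    exact Set.union_subset_union_left _ (Set.union_subset_union_right _ Set.subset_union_right)
  ------------------------------------------------------------------
  -- ### Step 2: finitely many purely inseparable constants `S ⊆ P`
  ------------------------------------------------------------------
  -- (2a) `K₁ ≤ (k ∪ S₁ ∪ (Y ∪ {t}))^h`
  obtain ⟨S₁, hS₁P, hS₁⟩ := exists_finset_closure_le_henselization_closure_levels V hkP
    (↑Y ∪ {t}) (B := (k : Set Ω)) (fun c hc => Subfield.subset_closure (Or.inl hc)) G
    (fun g hg => by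
      have := hK₁Y (hGK₁ hg)
      rwa [Set.union_assoc] at this)
  rw [hG] at hS₁
  -- (2b) `Y ⊆ (k ∪ S₂ ∪ K₁)^h`
  obtain ⟨S₂, hS₂P, hS₂⟩ := exists_finset_forall_mem_henselization_closure_levels V hkP
    (K₁ : Set Ω) Y (fun y hy => by
      have h1 : y ∈ henselization V (K₁ ⊔ P) := hCh (hYC hy)
      have h2 : K₁ ⊔ P ≤ Subfield.closure ((P : Set Ω) ∪ (K₁ : Set Ω)) :=
        sup_le (fun x hx => Subfield.subset_closure (Or.inr hx))
          (fun x hx => Subfield.subset_closure (Or.inl hx))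
      exact henselization_mono V hH h2 h1)
  -- (2c) `t ∈ closure (k ∪ S₃ ∪ (Y ∪ K₁))`
  obtain ⟨S₃, hS₃P, hS₃⟩ := exists_finset_forall_mem_closure_levels hkP (↑Y ∪ (K₁ : Set Ω)) {t}
    (fun z hz => by
      rw [Finset.mem_singleton.mp hz, ← Set.union_assoc]
      exact htY)
  have htS₃ := hS₃ t (Finset.mem_singleton_self t)
  -- (2d) separability over `k(S₄)`: the coefficients of the minimal polynomials over `P`
  have hYsepP : ∀ y ∈ Y, IsSeparable P y := fun y hy => hCsep y (hYC hy)
  set T : Finset Ω := Y.biUnion fun y => ((minpoly P y).support.image fun i =>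
    ((minpoly P y).coeff i : Ω)) with hTdef
  have hTP : ∀ z ∈ T, z ∈ Subfield.closure ((P : Set Ω) ∪ ∅) := by
    intro z hz
    obtain ⟨y, -, hz⟩ := Finset.mem_biUnion.mp hz
    obtain ⟨i, -, rfl⟩ := Finset.mem_image.mp hz
    rw [Set.union_empty]
    exact Subfield.subset_closure ((minpoly P y).coeff i).2
  obtain ⟨S₄, hS₄P, hS₄⟩ := exists_finset_forall_mem_closure_levels hkP (∅ : Set Ω) T hTP
  ------------------------------------------------------------------
  -- ### the common level `S = S₁ ∪ S₂ ∪ S₃ ∪ S₄`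
  ------------------------------------------------------------------
  set S : Finset Ω := S₁ ∪ S₂ ∪ S₃ ∪ S₄ with hSdef
  have hScoe : (↑S : Set Ω) = ↑S₁ ∪ ↑S₂ ∪ ↑S₃ ∪ ↑S₄ := by
    rw [hSdef, Finset.coe_union, Finset.coe_union, Finset.coe_union]
  have hSP : (↑S : Set Ω) ⊆ P := by
    rw [hScoe]
    exact Set.union_subset (Set.union_subset (Set.union_subset hS₁P hS₂P) hS₃P) hS₄P
  have h1S : (↑S₁ : Set Ω) ⊆ ↑S := by rw [hScoe]; exact fun x hx => Or.inl (Or.inl (Or.inl hx))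
  have h2S : (↑S₂ : Set Ω) ⊆ ↑S := by rw [hScoe]; exact fun x hx => Or.inl (Or.inl (Or.inr hx))
  have h3S : (↑S₃ : Set Ω) ⊆ ↑S := by rw [hScoe]; exact fun x hx => Or.inl (Or.inr hx)
  have h4S : (↑S₄ : Set Ω) ⊆ ↑S := by rw [hScoe]; exact fun x hx => Or.inr hx
  -- monotonicity of the levels in `S`
  have hmono : ∀ {S' : Finset Ω} (A : Set Ω), (↑S' : Set Ω) ⊆ ↑S →
      Subfield.closure ((k : Set Ω) ∪ ↑S' ∪ A) ≤ Subfield.closure ((k : Set Ω) ∪ ↑S ∪ A) :=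
    fun A h => Subfield.closure_mono
      (Set.union_subset_union_left _ (Set.union_subset_union_right _ h))
  refine ⟨S, Y, hSP, hYC, fun y hy => ?_, ?_, fun y hy => ?_, ?_⟩
  · -- separability over `k(S)`
    have hkS₄ : Subfield.closure ((k : Set Ω) ∪ ↑S₄ ∪ ∅) ≤ Subfield.closure ((k : Set Ω) ∪ ↑S) := by
      rw [Set.union_empty]
      exact Subfield.closure_mono (Set.union_subset_union_right _ h4S)
    have hkSP : Subfield.closure ((k : Set Ω) ∪ ↑S) ≤ P :=
      Subfield.closure_le.mpr (Set.union_subset hkP hSP)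
    refine isSeparable_of_forall_coeff_mem hkSP (hYsepP y hy) fun i => ?_
    by_cases hi : i ∈ (minpoly P y).support
    · exact hkS₄ (hS₄ _ (Finset.mem_biUnion.mpr ⟨y, hy, Finset.mem_image.mpr ⟨i, hi, rfl⟩⟩))
    · rw [Polynomial.notMem_support_iff.mp hi]
      exact Subfield.zero_mem _
  · -- `t ∈ K₁ ⊔ k(S, Y)`
    have hle : Subfield.closure ((k : Set Ω) ∪ ↑S₃ ∪ (↑Y ∪ (K₁ : Set Ω))) ≤
        K₁ ⊔ Subfield.closure ((k : Set Ω) ∪ ↑S ∪ ↑Y) := by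
      refine Subfield.closure_le.mpr ?_
      rintro x ((hx | hx) | (hx | hx))
      · exact (le_sup_right : _ ≤ K₁ ⊔ _) (Subfield.subset_closure (Or.inl (Or.inl hx)))
      · exact (le_sup_right : _ ≤ K₁ ⊔ _) (Subfield.subset_closure (Or.inl (Or.inr (h3S hx))))
      · exact (le_sup_right : _ ≤ K₁ ⊔ _) (Subfield.subset_closure (Or.inr hx))
      · exact (le_sup_left : K₁ ≤ K₁ ⊔ _) hx
    exact hle htS₃
  · -- `Y ⊆ (K₁ ⊔ k(S))^h`
    have hle : Subfield.closure ((k : Set Ω) ∪ ↑S₂ ∪ (K₁ : Set Ω)) ≤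
        K₁ ⊔ Subfield.closure ((k : Set Ω) ∪ ↑S) := by
      refine Subfield.closure_le.mpr ?_
      rintro x ((hx | hx) | hx)
      · exact (le_sup_right : _ ≤ K₁ ⊔ _) (Subfield.subset_closure (Or.inl hx))
      · exact (le_sup_right : _ ≤ K₁ ⊔ _) (Subfield.subset_closure (Or.inr (h2S hx)))
      · exact (le_sup_left : K₁ ≤ K₁ ⊔ _) hx
    exact henselization_mono V hH hle (hS₂ y hy)
  · -- `K₁ ≤ k(S, Y)(t)^h`
    refine hS₁.trans (henselization_mono V hH ?_)
    rw [Set.union_assoc ((k : Set Ω) ∪ ↑S)]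
    exact hmono _ h1S

end Literature.AlgebraicGeometry.Resolution

end
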